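import Summits.AtomisticToContinuum.Crystallization.Theorems.FrustratedLawDichotomyTwoShellRigidityCells
import Summits.AtomisticToContinuum.Crystallization.Theorems.FrustratedLawDichotomyCappedRigidityCertPatterns

/-!
# FrustratedLawDichotomy · crux `AperiodicFrustratedLawGap` (stmt-AtomisticToContinuum-27623) — THE COUPLED CLUSTER: ONE finite hypothesis
# set, THREE certificate targets (`M`, lens-5's `R = CoarseCappedRigidity`, lens-5's `L = BasinCertificate`)  (decomp-a2c, prover hand 2, gen 9)

`FrustratedLawDichotomyCappedRigidityCert` (p820515) typed the finite ℚ-mirror `CappedCert θ η Pat` of `M` with its hypotheses curried.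
`FrustratedLawDichotomyTwoShellRigidityCells` (lens-5 g30, p820618) split `M ⟸ R ∧ L` (`CoarseCappedRigidity K θ`: a coarse fit
`≤ K·θ·nn_i`; `BasinCertificate K θ η`: inside that basin the fit is `< η`) — both still quantified over arbitrary configurations.

Here the hypothesis set is named once — `CoupledCluster θ Pat p c` (the nd-COUPLED window set on the 19-cluster, = the six hypothesis
groups of `CappedCert`, census KR18-C's constraint set) — and extracted ONCE from the bond-graph semantics
(`exists_coupledCluster`: every injective configuration with `LinkIso θ Pat y i τ ∧ Capped θ Pat y i τ` yields, after rescaling by `nn_i⁻¹`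
about `y i`, a coupled cluster with shell `p u = nn_i⁻¹ • (y (τ u) − y i)`), so that THREE finite statements reduce three configuration
statements:
* `CappedCert θ η Pat ↔ ∀ p c, CoupledCluster θ Pat p c → ∃ η' < η, ∃ A, ‖p u − A u‖ ≤ η'` (`cappedCert_iff_coupled`) ⟹ `M` (p820515);
* `CoarseCert K θ Pat := ∀ p c, CoupledCluster θ Pat p c → ∃ A, ‖p u − A u‖ ≤ K·θ` ⟹ `CoarseCappedRigidityAt K θ Pat` (lens-5's R)
  — `coarseCappedRigidityAt_of_coarseCert`; the certificate-style alternative to the cell lemmas, on the COUPLED set (smaller `K`);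
* `BasinCert K θ η Pat := ∀ p c, CoupledCluster θ Pat p c → (∃ A₀, ‖p u − A₀ u‖ ≤ K·θ) → ∃ η' < η, ∃ A, ‖p u − A u‖ ≤ η'` ⟹
  `BasinCertificateAt K θ η Pat` (lens-5's L) — `basinCertificateAt_of_basinCert`: the LOCAL statement a Krawczyk / left-inverse
  certificate proves (linearisation at the pattern + remainder on the basin), with no global branch exclusion.
Both patterns: `coarseCappedRigidity_of_coarseCert`, `basinCertificate_of_basinCert`, `cappedRigidity_of_coarseCert_of_basinCert`
(`R_fin ∧ L_fin ⟹ M`), and by name `aperiodicFrustratedLawGap_of_coarseCert_of_basinCert`.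
`[folklore]` bookkeeping; no `sorry`; no `instance`/`notation`.
-/

noncomputable section

namespace Summit.AtomisticToContinuum.Crystallization.Theorems.FrustratedLawDichotomyCoupledCluster

open Literature.Geometry.DiscreteGeometry
open Summit.AtomisticToContinuum.Crystallization.Theses.PricedLinkCensus (ChargedEnergyGap)
open Summit.AtomisticToContinuum.Crystallization.Theorems.FrustratedLawDichotomyTwoShellRigidityCut
  (E3 LinkIso Capped CappedRigidityAt CappedRigidity LinkClassification CapForcing aperiodicFrustratedLawGap_of_cut
    noFrustratedPeriodicMinimiser_of_cut)
open Summit.AtomisticToContinuum.Crystallization.Theorems.FrustratedLawDichotomyCappedRigidityCert (capCluster CappedCert)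
open Summit.AtomisticToContinuum.Crystallization.Theorems.FrustratedLawDichotomyCappedRigidityCertPatterns
  (fcc_contactSeparating hcp_contactSeparating)
open Summit.AtomisticToContinuum.Crystallization.Theorems.FrustratedLawDichotomyTwoShellRigidityCells
  (CoarseCappedRigidityAt CoarseCappedRigidity BasinCertificateAt BasinCertificate cappedRigidity_of_coarse_of_basin)

/-- **`CoupledCluster θ Pat p c` — the nd-COUPLED window set on the 19-cluster** (centre `0`, unit `nn_i = 1`, shell `p`, caps `c a b` for
`dist a b = √2`): exactly the six hypothesis groups of `CappedCert` (radial window + distinct shell points; `nd(τu)`-coupling; contacts are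
coupled bonds; non-contacts are non-bonds; caps: radius `≥ 1`, not a shell point, not bonded to the centre, cap bonds coupled at both ends). -/
def CoupledCluster (θ : ℝ) (Pat : Finset E3) (p : ↥Pat → E3) (c : ↥Pat → ↥Pat → E3) : Prop :=
  (∀ u : ↥Pat, 1 ≤ ‖p u‖ ∧ ‖p u‖ ≤ 1 + θ) ∧
  Function.Injective p ∧
  (∀ u : ↥Pat, ∀ x ∈ capCluster p c, x ≠ p u → ‖p u‖ ≤ (1 + θ) * ‖p u - x‖) ∧
  (∀ u v : ↥Pat, dist (u : E3) (v : E3) = 1 →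
    ∀ x ∈ capCluster p c, x ≠ p u → ‖p u - p v‖ ≤ (1 + θ) * ‖p u - x‖) ∧
  (∀ u v : ↥Pat, u ≠ v → dist (u : E3) (v : E3) ≠ 1 → min ‖p u‖ ‖p v‖ < ‖p u - p v‖) ∧
  (∀ a b : ↥Pat, dist (a : E3) (b : E3) = Real.sqrt 2 →
    1 ≤ ‖c a b‖ ∧ (∀ w : ↥Pat, c a b ≠ p w) ∧
    (∀ w : ↥Pat, (w = a ∨ w = b ∨ (dist (w : E3) (a : E3) = 1 ∧ dist (w : E3) (b : E3) = 1)) →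
      min (1 + θ) ‖c a b - p w‖ < ‖c a b‖ ∧
      (∀ x ∈ capCluster p c, x ≠ c a b → ‖c a b - p w‖ ≤ (1 + θ) * ‖c a b - x‖) ∧
      (∀ x ∈ capCluster p c, x ≠ p w → ‖c a b - p w‖ ≤ (1 + θ) * ‖p w - x‖)))

/-- `CappedCert` (p820515, curried) is the finite statement «coupled cluster ⟹ fit `< η`». [folklore] -/
theorem cappedCert_iff_coupled {θ η : ℝ} {Pat : Finset E3} :
    CappedCert θ η Pat ↔ ∀ (p : ↥Pat → E3) (c : ↥Pat → ↥Pat → E3), CoupledCluster θ Pat p c →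
      ∃ (η' : ℝ) (A : E3 →ₗᵢ[ℝ] E3), η' < η ∧ ∀ u : ↥Pat, ‖p u - A (u : E3)‖ ≤ η' := by
  constructor
  · intro h p c hc
    exact h p c hc.1 hc.2.1 hc.2.2.1 hc.2.2.2.1 hc.2.2.2.2.1 hc.2.2.2.2.2
  · intro h p c h1 h2 h3 h4 h5 h6
    exact h p c ⟨h1, h2, h3, h4, h5, h6⟩

/-- **`CoarseCert K θ Pat` — the finite mirror of lens-5's `R = CoarseCappedRigidityAt K θ Pat`** on the COUPLED set: a coupled cluster
fits `A(Pat)` within `K·θ`. [certificate target; open for explicit `K` at `θ ≤ 1/100` (census KR18: law `≈ 3.95·θ` on the window model)] -/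
def CoarseCert (K θ : ℝ) (Pat : Finset E3) : Prop :=
  ∀ (p : ↥Pat → E3) (c : ↥Pat → ↥Pat → E3), CoupledCluster θ Pat p c →
    ∃ A : E3 →ₗᵢ[ℝ] E3, ∀ u : ↥Pat, ‖p u - A (u : E3)‖ ≤ K * θ

/-- **`BasinCert K θ η Pat` — the finite mirror of lens-5's `L = BasinCertificateAt K θ η Pat`**: a coupled cluster ALREADY within `K·θ`
of `A₀(Pat)` fits within some `η' < η` (the local, linearisable statement). [certificate target] -/
def BasinCert (K θ η : ℝ) (Pat : Finset E3) : Prop :=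
  ∀ (p : ↥Pat → E3) (c : ↥Pat → ↥Pat → E3), CoupledCluster θ Pat p c →
    (∃ A₀ : E3 →ₗᵢ[ℝ] E3, ∀ u : ↥Pat, ‖p u - A₀ (u : E3)‖ ≤ K * θ) →
      ∃ (η' : ℝ) (A : E3 →ₗᵢ[ℝ] E3), η' < η ∧ ∀ u : ↥Pat, ‖p u - A (u : E3)‖ ≤ η'

/-- Rescaling identity: `‖v − r • w‖ = r · ‖r⁻¹ • v − w‖` for `r > 0`. [folklore] -/
theorem norm_sub_smul_eq_mul {r : ℝ} (hr : 0 < r) (v w : E3) : ‖v - r • w‖ = r * ‖r⁻¹ • v - w‖ := by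
  rw [← Real.norm_of_nonneg hr.le, ← norm_smul, Real.norm_of_nonneg hr.le, smul_sub, smul_smul,
    mul_inv_cancel₀ hr.ne', one_smul]

/-- **THE EXTRACTION, ONCE.**  For a pattern whose contact graph separates points: every injective configuration with a `Pat`-isomorphic,
capped link at `i` yields — after rescaling by `nn_i⁻¹` about `y i` — a coupled cluster with shell `u ↦ nn_i⁻¹ • (y (τ u) − y i)`
(and `nn_i > 0`).  Every clause is read off `bondGraph_adj` / `nearestDist_le_dist`. [folklore] -/
theorem exists_coupledCluster {θ : ℝ} {Pat : Finset E3}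
    (hPat : ∀ u v : ↥Pat, u ≠ v → ∃ w : ↥Pat, dist (u : E3) (w : E3) = 1 ∧ dist (v : E3) (w : E3) ≠ 1)
    (hne : Nonempty ↥Pat) {N : ℕ} {y : Fin N → E3} {i : Fin N} {τ : ↥Pat → Fin N} (hy : Function.Injective y)
    (hL : LinkIso θ Pat y i τ) (hC : Capped θ Pat y i τ) :
    0 < nearestDist y i ∧
      ∃ c : ↥Pat → ↥Pat → E3, CoupledCluster θ Pat (fun u => (nearestDist y i)⁻¹ • (y (τ u) - y i)) c := by
  classical
  obtain ⟨u₀⟩ := hne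
  -- notation
  have hadj : ∀ {j k : Fin N}, (bondGraph θ y).Adj j k ↔
      j ≠ k ∧ dist (y j) (y k) ≤ (1 + θ) * min (nearestDist y j) (nearestDist y k) :=
    fun {j k} => bondGraph_adj
  have hτi : ∀ u, τ u ≠ i := fun u h => (hL.1 u).ne h.symm
  -- the unit `r = nn_i > 0`
  obtain ⟨k₀, hk₀, hr⟩ := exists_nearestDist_eq_dist y (j := i) ⟨τ u₀, hτi u₀⟩
  set r : ℝ := nearestDist y i with hr_def
  have hr0 : 0 < r := by
    rw [hr]
    exact dist_pos.2 fun h => hk₀ (hy h).symm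
  have hri : 0 < r⁻¹ := inv_pos.2 hr0
  -- `0 ≤ 1 + θ` (a bond exists)
  have hθ : 0 ≤ 1 + θ := by
    by_contra hneg
    have hlt := not_le.1 hneg
    obtain ⟨hne, hle⟩ := hadj.1 (hL.1 u₀)
    have hpos : 0 < dist (y i) (y (τ u₀)) := dist_pos.2 fun h => hne (hy h)
    have hmin : 0 ≤ min (nearestDist y i) (nearestDist y (τ u₀)) :=
      le_min (nearestDist_nonneg _ _) (nearestDist_nonneg _ _)
    nlinarith
  -- the rescaled configuration
  set q : Fin N → E3 := fun j => r⁻¹ • (y j - y i) with hq_def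
  have hq_sub : ∀ j l, ‖q j - q l‖ = r⁻¹ * dist (y j) (y l) := by
    intro j l
    simp only [hq_def]
    rw [← smul_sub, sub_sub_sub_cancel_right, norm_smul, Real.norm_of_nonneg hri.le, dist_eq_norm]
  have hqi : q i = 0 := by simp [hq_def]
  have hq_norm : ∀ j, ‖q j‖ = r⁻¹ * dist (y j) (y i) := by
    intro j
    have := hq_sub j i
    rwa [hqi, sub_zero] at this
  have hq_inj : Function.Injective q := by
    intro j l h
    have h0 : ‖q j - q l‖ = 0 := by rw [h, sub_self, norm_zero]
    rw [hq_sub] at h0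
    rcases mul_eq_zero.1 h0 with h1 | h1
    · exact absurd h1 hri.ne'
    · exact hy (dist_eq_zero.1 h1)
  -- generic fact A: every site other than `i` is at rescaled distance `≥ 1`
  have factA : ∀ j, j ≠ i → 1 ≤ ‖q j‖ := by
    intro j hj
    rw [hq_norm, dist_comm]
    have := nearestDist_le_dist y hj
    rw [← hr_def] at this
    calc (1 : ℝ) = r⁻¹ * r := by field_simp
      _ ≤ r⁻¹ * dist (y i) (y j) := mul_le_mul_of_nonneg_left this hri.le
  -- generic fact R: neighbours of `i` are at rescaled distance `≤ 1 + θ`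
  have factR : ∀ j, (bondGraph θ y).Adj i j → ‖q j‖ ≤ 1 + θ := by
    intro j hj
    obtain ⟨-, hle⟩ := hadj.1 hj
    rw [hq_norm, dist_comm]
    have h1 : dist (y i) (y j) ≤ (1 + θ) * r :=
      hle.trans (mul_le_mul_of_nonneg_left (min_le_left _ _) hθ)
    calc r⁻¹ * dist (y i) (y j) ≤ r⁻¹ * ((1 + θ) * r) := mul_le_mul_of_nonneg_left h1 hri.le
      _ = 1 + θ := by field_simp
  -- generic fact B: a bond `j ∼ k` is no longer than `(1+θ)·dist(j, l)` for every third site `l ≠ j`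
  have factB : ∀ j k l, (bondGraph θ y).Adj j k → l ≠ j → ‖q j - q k‖ ≤ (1 + θ) * ‖q j - q l‖ := by
    intro j k l hjk hlj
    obtain ⟨-, hle⟩ := hadj.1 hjk
    have h1 : dist (y j) (y k) ≤ (1 + θ) * dist (y j) (y l) :=
      hle.trans ((mul_le_mul_of_nonneg_left (min_le_left _ _) hθ).trans
        (mul_le_mul_of_nonneg_left (nearestDist_le_dist y hlj) hθ))
    rw [hq_sub, hq_sub]
    calc r⁻¹ * dist (y j) (y k) ≤ r⁻¹ * ((1 + θ) * dist (y j) (y l)) := mul_le_mul_of_nonneg_left h1 hri.le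
      _ = (1 + θ) * (r⁻¹ * dist (y j) (y l)) := by ring
  -- generic fact C: two distinct NON-bonded neighbours `j, k` of `i` are farther apart than the nearer of them is from `i`
  have factC : ∀ j k, (bondGraph θ y).Adj i j → (bondGraph θ y).Adj i k → j ≠ k → ¬ (bondGraph θ y).Adj j k →
      min ‖q j‖ ‖q k‖ < ‖q j - q k‖ := by
    intro j k hij hik hjk hnot
    have hgt : (1 + θ) * min (nearestDist y j) (nearestDist y k) < dist (y j) (y k) := by
      by_contra hle
      exact hnot (hadj.2 ⟨hjk, not_lt.1 hle⟩)
    obtain ⟨-, hj⟩ := hadj.1 hij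
    obtain ⟨-, hk⟩ := hadj.1 hik
    have hj' : dist (y j) (y i) ≤ (1 + θ) * nearestDist y j := by
      rw [dist_comm]; exact hj.trans (mul_le_mul_of_nonneg_left (min_le_right _ _) hθ)
    have hk' : dist (y k) (y i) ≤ (1 + θ) * nearestDist y k := by
      rw [dist_comm]; exact hk.trans (mul_le_mul_of_nonneg_left (min_le_right _ _) hθ)
    have hmin : min (dist (y j) (y i)) (dist (y k) (y i)) < dist (y j) (y k) := by
      rw [mul_min_of_nonneg _ _ hθ] at hgt
      exact lt_of_le_of_lt (min_le_min hj' hk') hgt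
    rw [hq_norm, hq_norm, hq_sub, ← mul_min_of_nonneg _ _ hri.le]
    exact mul_lt_mul_of_pos_left hmin hri
  -- generic fact D: a site `m ≠ i` NOT bonded to `i` but bonded to `a` satisfies `min (1+θ) ‖q m − q a‖ < ‖q m‖`
  have factD : ∀ m a, m ≠ i → ¬ (bondGraph θ y).Adj i m → (bondGraph θ y).Adj m a →
      min (1 + θ) ‖q m - q a‖ < ‖q m‖ := by
    intro m a hmi hnot hma
    have hgt : (1 + θ) * min (nearestDist y i) (nearestDist y m) < dist (y i) (y m) := by
      by_contra hle
      exact hnot (hadj.2 ⟨hmi.symm, not_lt.1 hle⟩)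
    obtain ⟨-, hle⟩ := hadj.1 hma
    have h1 : dist (y m) (y a) ≤ (1 + θ) * nearestDist y m :=
      hle.trans (mul_le_mul_of_nonneg_left (min_le_left _ _) hθ)
    have hmin : min ((1 + θ) * r) (dist (y m) (y a)) < dist (y m) (y i) := by
      rw [mul_min_of_nonneg _ _ hθ, ← hr_def, dist_comm] at hgt
      exact lt_of_le_of_lt (min_le_min le_rfl h1) hgt
    have := mul_lt_mul_of_pos_left hmin hri
    have h2 : r⁻¹ * ((1 + θ) * r) = 1 + θ := by field_simp
    rw [mul_min_of_nonneg _ _ hri.le, h2] at this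
    rw [hq_norm, hq_sub]
    exact this
  -- `τ` is injective (the contact graph of `Pat` separates points)
  have hτ : Function.Injective τ := by
    intro u v huv
    by_contra hne
    obtain ⟨w, huw, hvw⟩ := hPat u v hne
    have h1 : (bondGraph θ y).Adj (τ u) (τ w) := (hL.2.2 u w).2 huw
    rw [huv] at h1
    exact hvw ((hL.2.2 v w).1 h1)
  -- the caps
  set mcap : ↥Pat → ↥Pat → Fin N := fun a b =>
    if h : dist (a : E3) (b : E3) = Real.sqrt 2 then Classical.choose (hC a b h) else i with hmcap_def
  have hmcap : ∀ a b : ↥Pat, (h : dist (a : E3) (b : E3) = Real.sqrt 2) →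
      mcap a b ≠ i ∧ ∀ w : ↥Pat, (w = a ∨ w = b ∨ (dist (w : E3) (a : E3) = 1 ∧ dist (w : E3) (b : E3) = 1)) →
        (bondGraph θ y).Adj (mcap a b) (τ w) := by
    intro a b h
    have : mcap a b = Classical.choose (hC a b h) := by simp [hmcap_def, h]
    rw [this]
    exact Classical.choose_spec (hC a b h)
  -- a cap is not a shell site and is not bonded to the centre
  have hmcap_ne : ∀ a b : ↥Pat, dist (a : E3) (b : E3) = Real.sqrt 2 → ∀ w : ↥Pat, mcap a b ≠ τ w := by
    intro a b h w heq
    obtain ⟨-, hbond⟩ := hmcap a b h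
    have ha : (bondGraph θ y).Adj (mcap a b) (τ a) := hbond a (Or.inl rfl)
    have hb : (bondGraph θ y).Adj (mcap a b) (τ b) := hbond b (Or.inr (Or.inl rfl))
    rw [heq] at ha hb
    have hw : (bondGraph θ y).Adj (mcap a b) (τ w) :=
      hbond w (Or.inr (Or.inr ⟨(hL.2.2 w a).1 ha, (hL.2.2 w b).1 hb⟩))
    rw [heq] at hw
    exact hw.ne rfl
  have hmcap_centre : ∀ a b : ↥Pat, dist (a : E3) (b : E3) = Real.sqrt 2 → ¬ (bondGraph θ y).Adj i (mcap a b) := by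
    intro a b h hadj'
    obtain ⟨w, hw⟩ := hL.2.1 _ hadj'
    exact hmcap_ne a b h w hw.symm
  -- the finite data
  set p : ↥Pat → E3 := fun u => q (τ u) with hp_def
  set c : ↥Pat → ↥Pat → E3 := fun a b => q (mcap a b) with hc_def
  have hS : ∀ x ∈ capCluster p c, ∃ l, q l = x := by
    intro x hx
    rcases hx with rfl | hx
    · exact ⟨i, hqi⟩
    rcases hx with ⟨u, rfl⟩ | ⟨a, b, -, rfl⟩
    · exact ⟨τ u, rfl⟩
    · exact ⟨mcap a b, rfl⟩
  have hS' : ∀ {x} {j : Fin N}, x ∈ capCluster p c → x ≠ q j → ∃ l, l ≠ j ∧ q l = x := by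
    intro x j hx hne
    obtain ⟨l, rfl⟩ := hS x hx
    exact ⟨l, fun h => hne (by rw [h]), rfl⟩
  -- assemble the coupled cluster
  refine ⟨hr0, c, ?_⟩
  refine ⟨fun u => ⟨factA _ (hτi u), factR _ (hL.1 u)⟩, hq_inj.comp hτ, ?_, ?_, ?_, ?_⟩
  · intro u x hx hne'
    obtain ⟨l, hl, rfl⟩ := hS' hx hne'
    have := factB (τ u) i l (hL.1 u).symm hl
    rwa [hqi, sub_zero] at this
  · intro u v huv x hx hne'
    obtain ⟨l, hl, rfl⟩ := hS' hx hne'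
    exact factB (τ u) (τ v) l ((hL.2.2 u v).2 huv) hl
  · intro u v huv hd
    exact factC (τ u) (τ v) (hL.1 u) (hL.1 v) (hτ.ne huv) (fun h => hd ((hL.2.2 u v).1 h))
  · intro a b hab
    obtain ⟨hmi, hbond⟩ := hmcap a b hab
    refine ⟨factA _ hmi, fun w => hq_inj.ne (hmcap_ne a b hab w), fun w hw => ⟨?_, ?_, ?_⟩⟩
    · exact factD _ _ hmi (hmcap_centre a b hab) (hbond w hw)
    · intro x hx hne'
      obtain ⟨l, hl, rfl⟩ := hS' hx hne'
      exact factB _ _ l (hbond w hw) hl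
    · intro x hx hne'
      obtain ⟨l, hl, rfl⟩ := hS' hx hne'
      have := factB (τ w) (mcap a b) l (hbond w hw).symm hl
      rwa [norm_sub_rev (q (τ w)) (q (mcap a b))] at this

/-- **Finite-level chaining `R_fin ∧ L_fin ⟹ M_fin`**: `CoarseCert K θ Pat → BasinCert K θ η Pat → CappedCert θ η Pat`. [folklore] -/
theorem cappedCert_of_coarseCert_of_basinCert {K θ η : ℝ} {Pat : Finset E3} (hR : CoarseCert K θ Pat) (hL : BasinCert K θ η Pat) :
    CappedCert θ η Pat :=
  cappedCert_iff_coupled.2 fun p c hc => hL p c hc (hR p c hc)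

/-- **`CoarseCert K θ Pat ⟹ CoarseCappedRigidityAt K θ Pat`** (lens-5's R at one pattern, from the finite coupled statement). [folklore] -/
theorem coarseCappedRigidityAt_of_coarseCert {K θ : ℝ} {Pat : Finset E3}
    (hPat : ∀ u v : ↥Pat, u ≠ v → ∃ w : ↥Pat, dist (u : E3) (w : E3) = 1 ∧ dist (v : E3) (w : E3) ≠ 1)
    (hcert : CoarseCert K θ Pat) : CoarseCappedRigidityAt K θ Pat := by
  intro N y i τ hy _hsep hL hC
  rcases isEmpty_or_nonempty ↥Pat with hE | hne
  · exact ⟨LinearIsometry.id, fun u => (hE.false u).elim⟩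
  obtain ⟨hr0, c, hcl⟩ := exists_coupledCluster hPat hne hy hL hC
  obtain ⟨A, hA⟩ := hcert _ c hcl
  refine ⟨A, fun u => ?_⟩
  rw [norm_sub_smul_eq_mul hr0]
  calc nearestDist y i * ‖(nearestDist y i)⁻¹ • (y (τ u) - y i) - A (u : E3)‖
      ≤ nearestDist y i * (K * θ) := mul_le_mul_of_nonneg_left (hA u) hr0.le
    _ = K * θ * nearestDist y i := by ring

/-- **`BasinCert K θ η Pat ⟹ BasinCertificateAt K θ η Pat`** (lens-5's L at one pattern, from the finite local statement). [folklore] -/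
theorem basinCertificateAt_of_basinCert {K θ η : ℝ} {Pat : Finset E3}
    (hPat : ∀ u v : ↥Pat, u ≠ v → ∃ w : ↥Pat, dist (u : E3) (w : E3) = 1 ∧ dist (v : E3) (w : E3) ≠ 1)
    (hcert : BasinCert K θ η Pat) : BasinCertificateAt K θ η Pat := by
  intro N y i τ hy _hsep hL hC hbasin
  rcases isEmpty_or_nonempty ↥Pat with hE | hne
  · exact ⟨η - 1, LinearIsometry.id, by linarith, fun u => (hE.false u).elim⟩
  obtain ⟨hr0, c, hcl⟩ := exists_coupledCluster hPat hne hy hL hC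
  obtain ⟨A₀, hA₀⟩ := hbasin
  have hb : ∃ A₀ : E3 →ₗᵢ[ℝ] E3, ∀ u : ↥Pat, ‖(nearestDist y i)⁻¹ • (y (τ u) - y i) - A₀ (u : E3)‖ ≤ K * θ := by
    refine ⟨A₀, fun u => ?_⟩
    have h := hA₀ u
    rw [norm_sub_smul_eq_mul hr0] at h
    have : nearestDist y i * ‖(nearestDist y i)⁻¹ • (y (τ u) - y i) - A₀ (u : E3)‖ ≤ nearestDist y i * (K * θ) := by
      calc _ ≤ K * θ * nearestDist y i := h
        _ = nearestDist y i * (K * θ) := by ring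
    exact le_of_mul_le_mul_left this hr0
  obtain ⟨η', A, hη', hA⟩ := hcert _ c hcl hb
  refine ⟨η', A, hη', fun u => ?_⟩
  rw [norm_sub_smul_eq_mul hr0]
  calc nearestDist y i * ‖(nearestDist y i)⁻¹ • (y (τ u) - y i) - A (u : E3)‖
      ≤ nearestDist y i * η' := mul_le_mul_of_nonneg_left (hA u) hr0.le
    _ = η' * nearestDist y i := by ring

/-- **R at both patterns from the two finite coarse certificates.** [folklore] -/
theorem coarseCappedRigidity_of_coarseCert {K θ : ℝ} (hf : CoarseCert K θ fccKissingPattern) (hh : CoarseCert K θ hcpKissingPattern) :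
    CoarseCappedRigidity K θ :=
  ⟨coarseCappedRigidityAt_of_coarseCert fcc_contactSeparating hf, coarseCappedRigidityAt_of_coarseCert hcp_contactSeparating hh⟩

/-- **L at both patterns from the two finite basin certificates.** [folklore] -/
theorem basinCertificate_of_basinCert {K θ η : ℝ} (hf : BasinCert K θ η fccKissingPattern) (hh : BasinCert K θ η hcpKissingPattern) :
    BasinCertificate K θ η :=
  ⟨basinCertificateAt_of_basinCert fcc_contactSeparating hf, basinCertificateAt_of_basinCert hcp_contactSeparating hh⟩

/-- **`M` from the four finite certificates `R_fin(fcc, hcp) ∧ L_fin(fcc, hcp)`** (through lens-5's `cappedRigidity_of_coarse_of_basin`).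
[folklore] -/
theorem cappedRigidity_of_coarseCert_of_basinCert {K θ η : ℝ}
    (hRf : CoarseCert K θ fccKissingPattern) (hRh : CoarseCert K θ hcpKissingPattern)
    (hLf : BasinCert K θ η fccKissingPattern) (hLh : BasinCert K θ η hcpKissingPattern) : CappedRigidity θ η :=
  cappedRigidity_of_coarse_of_basin (coarseCappedRigidity_of_coarseCert hRf hRh) (basinCertificate_of_basinCert hLf hLh)

/-- **The crux of item 27623 BY NAME from `MuEquilibriumDoor ∧ ChargedEnergyGap ∧ G ∧ P` and the four finite certificates at
`θ = 1/100`, `η = 1/20`.** [folklore] -/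
theorem aperiodicFrustratedLawGap_of_coarseCert_of_basinCert {K : ℝ}
    (hDoor : Summit.AtomisticToContinuum.Crystallization.Theses.GrainCoreNetworkSplit.MuEquilibriumDoor) (hgap : ChargedEnergyGap)
    (hG : LinkClassification (1 / 100)) (hP : CapForcing (1 / 100))
    (hRf : CoarseCert K (1 / 100) fccKissingPattern) (hRh : CoarseCert K (1 / 100) hcpKissingPattern)
    (hLf : BasinCert K (1 / 100) (1 / 20) fccKissingPattern) (hLh : BasinCert K (1 / 100) (1 / 20) hcpKissingPattern) :
    Summit.AtomisticToContinuum.Crystallization.Theses.FrustratedLawDichotomy.AperiodicFrustratedLawGap :=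
  aperiodicFrustratedLawGap_of_cut hDoor hgap hG hP (cappedRigidity_of_coarseCert_of_basinCert hRf hRh hLf hLh)

/-- **Item 26654 `NoFrustratedPeriodicMinimiser`, door-free, from `ChargedEnergyGap ∧ G ∧ P` and the four finite certificates.** [folklore] -/
theorem noFrustratedPeriodicMinimiser_of_coarseCert_of_basinCert {K : ℝ} (hgap : ChargedEnergyGap)
    (hG : LinkClassification (1 / 100)) (hP : CapForcing (1 / 100))
    (hRf : CoarseCert K (1 / 100) fccKissingPattern) (hRh : CoarseCert K (1 / 100) hcpKissingPattern)
    (hLf : BasinCert K (1 / 100) (1 / 20) fccKissingPattern) (hLh : BasinCert K (1 / 100) (1 / 20) hcpKissingPattern) :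
    Summit.AtomisticToContinuum.Crystallization.Theses.PeriodicChargeSplit.NoFrustratedPeriodicMinimiser :=
  noFrustratedPeriodicMinimiser_of_cut hgap hG hP (cappedRigidity_of_coarseCert_of_basinCert hRf hRh hLf hLh)

end Summit.AtomisticToContinuum.Crystallization.Theorems.FrustratedLawDichotomyCoupledCluster

end
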